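import Literature.NumberTheory.EllipticCurves.DeShalit1987.KatzDistributionFromLMeasure

/-!
# STUB-IDEAS k2 g38 — «CONE DENSITY»: de Shalit's L-measure is UNIQUE as a functional
# from the tree's 𝔭-UNRAMIFIED interpolation range alone (Kaplansky 1950 transplanted)

Stub-ideation sketch for `stub_heegnerIndexLowerAtTwo` of crux `SplitBadTwoLowerHalfOfFacts`
(route PrintCf2).  BSD is NOT proved by any of this.

What is PROVED here (sorry-free):
* `mul_mem_span_of_mul_mem`      — the 𝕜-span of a multiplicatively closed set of functions is
                                    multiplicatively closed (H1a);
* `integral_eq_of_dense_span`     — two bounded distributions (on possibly DIFFERENT towers) whose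
                                    integrals agree on a test set `T` agree on every function that is a
                                    uniform limit of `span T` (H1, abstract density transfer);
* `avatarValueAt_eq_one_of_mem_rayKer` — an avatar killing de Shalit's ray generators kills `rayKer`;
* `isLMeasure_integral_unique`    — (U) GIVEN Kaplansky's non-archimedean Stone–Weierstrass theorem
                                    (H2, a 1950 THEOREM, stated as the Prop `KaplanskyDensityModN`),
                                    the separation statement H3 (`ConeSeparatesRayClasses`, class field
                                    theory of the imaginary quadratic field: the type-(−m,j) avatars are
                                    injective on the `v`-inertia line that the `v`-unramified finite-order
                                    characters miss) and multiplicative closure of the cone H4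
                                    (`ConeMulClosed`), ANY two `IsLMeasure` witnesses — on any two admissible
                                    towers, same `(ι, v, v̄, S, Ω, δ, Ω_p)` — have the same integral on every
                                    continuous `rayKer`-invariant function;
* `integral_avatar_witness_independent` — (G1) in particular the OUT-OF-RANGE values
                                    `∫ χ̂ dμ` at `𝔭`-RAMIFIED finite-order `χ` (the (KLF-COSET)₂ atom of
                                    R197a″) are witness-independent — DETERMINED, not computed (K22 guard);
* `forall_of_exists_isLMeasure`   — (G2) the ∀/∃ exchange for any property of such a value.
-/

noncomputable section

open Filter
open scoped Topology
open NumberField IsDedekindDomain Field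
open Literature.NumberTheory.EllipticCurves Literature.NumberTheory.GaloisRepresentations

namespace Summit.BirchSwinnertonDyer.BirchSwinnertonDyer.Cruxes.SplitBadTwoLowerHalfOfFacts.ConeDensityK2G38

/-! ## §1  Abstract layer (H1a, H1): density transfer of integral identities -/

section Abstract

variable {G : Type*} {𝕜 : Type*} [NormedField 𝕜]

/-- **H1a.** The `𝕜`-span of a multiplicatively closed set of functions `G → 𝕜` is multiplicatively
closed. -/
theorem mul_mem_span_of_mul_mem {T : Set (G → 𝕜)} (hT : ∀ f ∈ T, ∀ g ∈ T, f * g ∈ T)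
    {f g : G → 𝕜} (hf : f ∈ Submodule.span 𝕜 T) (hg : g ∈ Submodule.span 𝕜 T) :
    f * g ∈ Submodule.span 𝕜 T := by
  induction hf using Submodule.span_induction generalizing g with
  | mem x hx =>
    induction hg using Submodule.span_induction with
    | mem y hy => exact Submodule.subset_span (hT x hx y hy)
    | zero => simp
    | add y z _ _ hy hz => rw [mul_add]; exact Submodule.add_mem _ hy hz
    | smul a y _ hy => rw [mul_smul_comm]; exact Submodule.smul_mem _ a hy
  | zero => simp
  | add x y _ _ hx hy => rw [add_mul]; exact Submodule.add_mem _ (hx hg) (hy hg)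
  | smul a x _ hx => rw [smul_mul_assoc]; exact Submodule.smul_mem _ a (hx hg)

variable [Group G] [CompleteSpace 𝕜] [IsUltrametricDist 𝕜]

/-- **H1 (density transfer).** Two bounded distributions `D, D'` on `G`, along possibly different
towers, whose integrals agree on a test set `T` of functions tower-continuous for both, have the same
integral on every `f` (tower-continuous for both) that is a uniform limit of `span_𝕜 T`. -/
theorem integral_eq_of_dense_span {𝒰 𝒰' : SubgroupTower G} (D : GroupDistribution 𝒰 𝕜)
    (D' : GroupDistribution 𝒰' 𝕜) (T : Set (G → 𝕜))
    (hT : ∀ t ∈ T, 𝒰.IsTowerContinuous t) (hT' : ∀ t ∈ T, 𝒰'.IsTowerContinuous t)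
    (hagree : ∀ t ∈ T, D.integral t = D'.integral t)
    {f : G → 𝕜} (hf : 𝒰.IsTowerContinuous f) (hf' : 𝒰'.IsTowerContinuous f)
    (hdense : ∀ ε : ℝ, 0 < ε → ∃ g ∈ Submodule.span 𝕜 T, ∀ σ, ‖f σ - g σ‖ ≤ ε) :
    D.integral f = D'.integral f := by
  -- agreement and tower-continuity on the whole span
  have hspan : ∀ g ∈ Submodule.span 𝕜 T,
      𝒰.IsTowerContinuous g ∧ 𝒰'.IsTowerContinuous g ∧ D.integral g = D'.integral g := by
    intro g hg
    induction hg using Submodule.span_induction with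
    | mem x hx => exact ⟨hT x hx, hT' x hx, hagree x hx⟩
    | zero =>
      exact ⟨SubgroupTower.IsTowerContinuous.const (0 : 𝕜), SubgroupTower.IsTowerContinuous.const (0 : 𝕜),
        by simp [show (0 : G → 𝕜) = fun _ => (0 : 𝕜) from rfl, GroupDistribution.integral_const]⟩
    | add x y _ _ hx hy =>
      refine ⟨hx.1.add hy.1, hx.2.1.add hy.2.1, ?_⟩
      change D.integral (fun σ => x σ + y σ) = D'.integral (fun σ => x σ + y σ)
      rw [D.integral_add hx.1 hy.1, D'.integral_add hx.2.1 hy.2.1, hx.2.2, hy.2.2]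
    | smul a x _ hx =>
      have hax : (a • x : G → 𝕜) = fun σ => a * x σ := by funext σ; simp [smul_eq_mul]
      refine ⟨?_, ?_, ?_⟩
      · rw [hax]; exact hx.1.const_mul a
      · rw [hax]; exact hx.2.1.const_mul a
      · rw [hax, D.integral_const_mul a hx.1, D'.integral_const_mul a hx.2.1, hx.2.2]
  -- an approximating sequence from the span
  have hd : ∀ k : ℕ, ∃ g ∈ Submodule.span 𝕜 T, ∀ σ, ‖f σ - g σ‖ ≤ 1 / ((k : ℝ) + 1) :=
    fun k => hdense _ (by positivity)
  choose g hg_mem hg_le using hd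
  have hlim : Tendsto (fun k : ℕ => 1 / ((k : ℝ) + 1)) atTop (𝓝 0) :=
    tendsto_one_div_add_atTop_nhds_zero_nat
  have he : ∀ k σ, ‖g k σ - f σ‖ ≤ 1 / ((k : ℝ) + 1) := fun k σ => by
    rw [norm_sub_rev]; exact hg_le k σ
  have h1 : Tendsto (fun k => D.integral (g k)) atTop (𝓝 (D.integral f)) :=
    D.tendsto_integral_of_forall_norm_sub_le (fun k => (hspan _ (hg_mem k)).1) hf
      (fun k => by positivity) he hlim
  have h2 : Tendsto (fun k => D'.integral (g k)) atTop (𝓝 (D'.integral f)) :=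
    D'.tendsto_integral_of_forall_norm_sub_le (fun k => (hspan _ (hg_mem k)).2.1) hf'
      (fun k => by positivity) he hlim
  have h2' : Tendsto (fun k => D.integral (g k)) atTop (𝓝 (D'.integral f)) :=
    h2.congr fun k => ((hspan _ (hg_mem k)).2.2).symm
  exact tendsto_nhds_unique h1 h2'

end Abstract

/-! ## §2  H2 — Kaplansky's non-archimedean Stone–Weierstrass theorem (1950), as named Props

I. Kaplansky, *The Weierstrass theorem in fields with valuations*, Proc. AMS 1 (1950) 356–357,
THEOREM: `X` compact Hausdorff totally disconnected, `F` a rank-one valued field (more generally a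
topological division ring of type V), `D ⊆ C(X, F)` a closed subalgebra (no unit required) such that
for all `x ≠ y` there is `f ∈ D` with `f x = 0`, `f y ≠ 0`; then `D = C(X, F)`.
Mathlib has only the real / `RCLike` Stone–Weierstrass; this is a LITERATURE FACT to be typed under
`Literature/Analysis/…` (proof: Kaplansky's Lemma 1 + Lemma 2, two pages).  Form A is the verbatim
statement; Form B ("mod `N` on a compact group") is the shape consumed below (A ⇒ B: pass to the
quotient space `G ⧸ N`, routine topology). -/

section Kaplansky

/-- **H2, Form A (Kaplansky 1950, THEOREM, density phrasing).** -/
def KaplanskyStoneWeierstrass : Prop :=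
  ∀ (X : Type) [TopologicalSpace X] [CompactSpace X] [T2Space X] [TotallyDisconnectedSpace X]
    (𝕜 : Type) [NontriviallyNormedField 𝕜] [IsUltrametricDist 𝕜]
    (A : NonUnitalSubalgebra 𝕜 C(X, 𝕜)),
    (∀ x y : X, x ≠ y → ∃ f ∈ A, f x = 0 ∧ f y ≠ 0) →
    ∀ (f : C(X, 𝕜)) (ε : ℝ), 0 < ε → ∃ g ∈ A, ‖f - g‖ ≤ ε

/-- **H2, Form B (Kaplansky mod `N`).** On a compact Hausdorff totally disconnected topological group
`G` with a closed subgroup `N`: a `𝕜`-submodule `A` of continuous, right-`N`-invariant functions, closed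
under products and separating `N`-classes in Kaplansky's pointed sense, is uniformly dense in the
continuous right-`N`-invariant functions. -/
def KaplanskyDensityModN : Prop :=
  ∀ (G : Type) [Group G] [TopologicalSpace G] [IsTopologicalGroup G] [CompactSpace G] [T2Space G]
    [TotallyDisconnectedSpace G] (N : Subgroup G), IsClosed (N : Set G) →
    ∀ (𝕜 : Type) [NontriviallyNormedField 𝕜] [IsUltrametricDist 𝕜] (A : Submodule 𝕜 (G → 𝕜)),
    (∀ f ∈ A, Continuous f) →
    (∀ f ∈ A, ∀ σ τ : G, σ⁻¹ * τ ∈ N → f σ = f τ) →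
    (∀ f ∈ A, ∀ g ∈ A, f * g ∈ A) →
    (∀ σ τ : G, σ⁻¹ * τ ∉ N → ∃ f ∈ A, f σ = 0 ∧ f τ ≠ 0) →
    ∀ f : G → 𝕜, Continuous f → (∀ σ τ : G, σ⁻¹ * τ ∈ N → f σ = f τ) →
    ∀ ε : ℝ, 0 < ε → ∃ g ∈ A, ∀ σ, ‖f σ - g σ‖ ≤ ε

end Kaplansky

/-! ## §3  The de Shalit layer: the test cone, H3, H4, and the uniqueness theorem U -/

section DeShalit

variable {p : ℕ} [Fact p.Prime] {K : Type} [Field K] [NumberField K]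

/-- **The test cone** `T_S`: the avatars `σ ↦ ε̂_{dS}⁻¹(σ)` of the Hecke characters in the tree's
`IsLMeasure` interpolation range — `p`-adic avatar outside `S`, type `(−m, j)` with `0 ≤ j < m`,
unramified outside `S ∪ {v̄}` (so UNRAMIFIED AT `v = 𝔭`), with an entire `L`-function. -/
def lTestCone (S : Finset (HeightOneSpectrum (𝓞 K))) (ι : PadicAlgCl p ≃+* ℂ)
    (vbar : HeightOneSpectrum (𝓞 K)) : Set (absoluteGaloisGroup K → ℂ_[p]) :=
  {f | ∃ (ε : HeckeCharacter K) (e : FramedGaloisRep K (PadicAlgCl p) 1) (m j : ℕ),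
      IsPAdicAvatarOutside S ι ε e ∧ j < m ∧
      ε.HasInfinityType (fun _ ↦ -(m : ℤ)) (fun _ ↦ (j : ℤ)) ∧
      (∀ w : HeightOneSpectrum (𝓞 K), w ∉ S → w ≠ vbar → ε.IsUnramifiedAt w) ∧
      LFunction.HasEntireContinuation (heckeLFunction ε) ∧
      f = fun σ ↦ avatarValueAt e σ}

/-- **H3 (separation; class field theory of the imaginary quadratic field).** The cone separates the
classes of `Γ_K` modulo `rayKer K p S = Gal(K̄/K(𝔣p^∞))`.  TRUE when `K` is imaginary quadratic, `p`
splits as `v v̄`, `v, v̄ ∉ S`, and `ι` pins `v`: the finite-order characters unramified outside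
`S ∪ {v̄}` cut `𝒢(𝔣p^∞)` down to the `v`-inertia line `D_v = Art_v(𝒪_vˣ) ≅ ℤ_pˣ` (injective for
imaginary quadratic `K`, de Shalit II.4.13), and on `D_v` the avatar of a cone character of type
`(−m, j)` is `u ↦ u^{a}` with `a` the `v`-slot exponent, `a ∈ {−m} ∪ {j}` — injective for `a = ∓1`
(types `(−1,0)` / `(−2,1)`).  Helper lemma of the line (M). -/
def ConeSeparatesRayClasses (S : Finset (HeightOneSpectrum (𝓞 K))) (ι : PadicAlgCl p ≃+* ℂ)
    (vbar : HeightOneSpectrum (𝓞 K)) : Prop :=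
  ∀ σ τ : absoluteGaloisGroup K, σ⁻¹ * τ ∉ DeShalit1987.rayKer K p S →
    ∃ f ∈ lTestCone (p := p) S ι vbar, f σ ≠ f τ

/-- **H4 (the cone is multiplicatively closed).** Product of avatars = avatar of the product
(`IsPAdicAvatarOf.mul_twist_outside` pattern), types add (`j₁ + j₂ < m₁ + m₂`), ramification and the
entire continuation are preserved.  Helper lemma of the line (S). -/
def ConeMulClosed (S : Finset (HeightOneSpectrum (𝓞 K))) (ι : PadicAlgCl p ≃+* ℂ)
    (vbar : HeightOneSpectrum (𝓞 K)) : Prop :=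
  ∀ f ∈ lTestCone (p := p) S ι vbar, ∀ g ∈ lTestCone (p := p) S ι vbar,
    f * g ∈ lTestCone (p := p) S ι vbar

/-- The avatar as a monoid homomorphism `Γ_K →* ℂ_p`. -/
def avatarHom (e : FramedGaloisRep K (PadicAlgCl p) 1) : absoluteGaloisGroup K →* ℂ_[p] where
  toFun σ := avatarValueAt e σ
  map_one' := avatarValueAt_one e
  map_mul' := avatarValueAt_mul e

omit [NumberField K] in
@[simp] theorem avatarHom_apply (e : FramedGaloisRep K (PadicAlgCl p) 1) (σ : absoluteGaloisGroup K) :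
    avatarHom e σ = avatarValueAt e σ := rfl

omit [NumberField K] in
/-- The kernel of an avatar is closed and contains the commutators. -/
theorem isClosed_ker_avatarHom (e : FramedGaloisRep K (PadicAlgCl p) 1) :
    IsClosed (((avatarHom e).toHomUnits.ker : Subgroup (absoluteGaloisGroup K)) :
      Set (absoluteGaloisGroup K)) := by
  have hset : (((avatarHom e).toHomUnits.ker : Subgroup (absoluteGaloisGroup K)) :
      Set (absoluteGaloisGroup K)) = {σ | avatarValueAt e σ = 1} := by
    ext σ
    simp only [SetLike.mem_coe, MonoidHom.mem_ker, Set.mem_setOf_eq]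
    rw [← Units.val_eq_one, MonoidHom.coe_toHomUnits, avatarHom_apply]
  rw [hset]
  exact isClosed_eq (continuous_avatarValueAt e) continuous_const

/-- **An avatar killing de Shalit's ray generators kills `rayKer K p S`.** -/
theorem avatarValueAt_eq_one_of_mem_rayKer {S : Finset (HeightOneSpectrum (𝓞 K))}
    (e : FramedGaloisRep K (PadicAlgCl p) 1)
    (hgen : ∀ s ∈ DeShalit1987.rayGenerators K p S, avatarValueAt e s = 1)
    {σ : absoluteGaloisGroup K} (hσ : σ ∈ DeShalit1987.rayKer K p S) : avatarValueAt e σ = 1 := by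
  have hsub : DeShalit1987.rayGenerators K p S ⊆
      (((avatarHom e).toHomUnits.ker : Subgroup (absoluteGaloisGroup K)) : Set (absoluteGaloisGroup K)) := by
    intro s hs
    simp only [SetLike.mem_coe, MonoidHom.mem_ker]
    rw [← Units.val_eq_one, MonoidHom.coe_toHomUnits, avatarHom_apply]
    exact hgen s hs
  have hle : DeShalit1987.rayKer K p S ≤ (avatarHom e).toHomUnits.ker :=
    Subgroup.topologicalClosure_minimal _ (Subgroup.normalClosure_le_normal hsub)
      (isClosed_ker_avatarHom e)
  have h := hle hσ
  rw [MonoidHom.mem_ker, ← Units.val_eq_one, MonoidHom.coe_toHomUnits, avatarHom_apply] at h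
  exact h

/-- Cone avatars kill the ray generators (commutators: values commute; inertia at `w ∉ S`, `w ∤ p`:
`IsPAdicAvatarOutside` + unramifiedness of `ε` there). -/
theorem avatarValueAt_eq_one_of_mem_rayGenerators {S : Finset (HeightOneSpectrum (𝓞 K))}
    {ι : PadicAlgCl p ≃+* ℂ} {ε : HeckeCharacter K} {e : FramedGaloisRep K (PadicAlgCl p) 1}
    (he : IsPAdicAvatarOutside S ι ε e)
    (hunr : ∀ w : HeightOneSpectrum (𝓞 K), w ∉ S → ((p : ℕ) : 𝓞 K) ∉ w.asIdeal → ε.IsUnramifiedAt w)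
    {s : absoluteGaloisGroup K} (hs : s ∈ DeShalit1987.rayGenerators K p S) : avatarValueAt e s = 1 := by
  rcases DeShalit1987.mem_rayGenerators_iff.mp hs with hs | ⟨w, hwS, hwp, 𝔓, h𝔓, hσ⟩
  · have hle : commutator (absoluteGaloisGroup K) ≤ (avatarHom e).toHomUnits.ker :=
      Abelianization.commutator_subset_ker _
    have h := hle hs
    rw [MonoidHom.mem_ker, ← Units.val_eq_one, MonoidHom.coe_toHomUnits, avatarHom_apply] at h
    exact h
  · have h : e s = 1 := (he w hwS hwp (hunr w hwS hwp)).1 𝔓 h𝔓 s hσ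
    rw [avatarValueAt, h]
    simp

/-- Right-`rayKer`-invariance of a function killing... (multiplicative form): if an avatar kills
`rayKer` then it is constant on `rayKer`-classes. -/
theorem avatarValueAt_eq_of_inv_mul_mem_rayKer {S : Finset (HeightOneSpectrum (𝓞 K))}
    (e : FramedGaloisRep K (PadicAlgCl p) 1)
    (hgen : ∀ s ∈ DeShalit1987.rayGenerators K p S, avatarValueAt e s = 1)
    {σ τ : absoluteGaloisGroup K} (h : σ⁻¹ * τ ∈ DeShalit1987.rayKer K p S) :
    avatarValueAt e σ = avatarValueAt e τ := by
  have h1 := avatarValueAt_eq_one_of_mem_rayKer e hgen h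
  have : τ = σ * (σ⁻¹ * τ) := by group
  rw [this, avatarValueAt_mul, h1, mul_one]

variable {S : Finset (HeightOneSpectrum (𝓞 K))} {ι : PadicAlgCl p ≃+* ℂ}
  {v vbar : HeightOneSpectrum (𝓞 K)} {Ω δ : ℂ} {Ωp : ℂ_[p]}

omit [Fact p.Prime] in
/-- Unramifiedness outside `S ∪ {v̄}` implies unramifiedness outside `S` away from `p` when `v̄ ∣ p`. -/
theorem unr_away_from_p (hvbar : ((p : ℕ) : 𝓞 K) ∈ vbar.asIdeal) {ε : HeckeCharacter K}
    (hunr : ∀ w : HeightOneSpectrum (𝓞 K), w ∉ S → w ≠ vbar → ε.IsUnramifiedAt w) :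
    ∀ w : HeightOneSpectrum (𝓞 K), w ∉ S → ((p : ℕ) : 𝓞 K) ∉ w.asIdeal → ε.IsUnramifiedAt w :=
  fun w hwS hwp ↦ hunr w hwS fun h ↦ hwp (h ▸ hvbar)

/-- Every cone function is continuous, of norm one, kills the ray generators, and is tower-continuous
along every admissible tower. -/
theorem cone_props (hvbar : ((p : ℕ) : 𝓞 K) ∈ vbar.asIdeal)
    {𝒰 : SubgroupTower (absoluteGaloisGroup K)} (hU : ∀ n, IsOpen (𝒰.U n : Set (absoluteGaloisGroup K)))
    (hN : ⋂ n, (𝒰.U n : Set (absoluteGaloisGroup K)) ⊆ DeShalit1987.rayKer K p S)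
    {t : absoluteGaloisGroup K → ℂ_[p]} (ht : t ∈ lTestCone (p := p) S ι vbar) :
    Continuous t ∧ (∀ σ, ‖t σ‖ = 1) ∧
      (∀ σ τ : absoluteGaloisGroup K, σ⁻¹ * τ ∈ DeShalit1987.rayKer K p S → t σ = t τ) ∧
      𝒰.IsTowerContinuous t := by
  obtain ⟨ε, e, m, j, he, -, -, hunr, -, rfl⟩ := ht
  have hunr' := unr_away_from_p hvbar hunr
  have hgen : ∀ s ∈ DeShalit1987.rayGenerators K p S, avatarValueAt e s = 1 :=
    fun s hs ↦ avatarValueAt_eq_one_of_mem_rayGenerators he hunr' hs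
  exact ⟨continuous_avatarValueAt e, norm_avatarValueAt_eq_one e,
    fun σ τ h ↦ avatarValueAt_eq_of_inv_mul_mem_rayKer e hgen h,
    DeShalit1987.isTowerContinuous_avatarValueAt he hunr' hU hN⟩

/-- Two `IsLMeasure` witnesses agree on the cone (both sides equal the interpolation value (50)). -/
theorem integral_eq_on_cone (hvbar : ((p : ℕ) : 𝓞 K) ∈ vbar.asIdeal)
    {𝒰 𝒰' : SubgroupTower (absoluteGaloisGroup K)}
    (hU : ∀ n, IsOpen (𝒰.U n : Set (absoluteGaloisGroup K)))
    (hN : ⋂ n, (𝒰.U n : Set (absoluteGaloisGroup K)) ⊆ DeShalit1987.rayKer K p S)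
    (hU' : ∀ n, IsOpen (𝒰'.U n : Set (absoluteGaloisGroup K)))
    (hN' : ⋂ n, (𝒰'.U n : Set (absoluteGaloisGroup K)) ⊆ DeShalit1987.rayKer K p S)
    {μ : GroupDistribution 𝒰 ℂ_[p]} {μ' : GroupDistribution 𝒰' ℂ_[p]}
    (hμ : DeShalit1987.IsLMeasure ι v vbar S Ω δ Ωp 𝒰 μ)
    (hμ' : DeShalit1987.IsLMeasure ι v vbar S Ω δ Ωp 𝒰' μ')
    {t : absoluteGaloisGroup K → ℂ_[p]} (ht : t ∈ lTestCone (p := p) S ι vbar) :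
    μ.integral t = μ'.integral t := by
  obtain ⟨ε, e, m, j, he, hjm, htyp, hunr, hL, rfl⟩ := ht
  have hunr' := unr_away_from_p hvbar hunr
  rw [hμ ε e m j he hjm htyp hunr (DeShalit1987.isTowerContinuous_avatarValueAt he hunr' hU hN) hL,
    hμ' ε e m j he hjm htyp hunr (DeShalit1987.isTowerContinuous_avatarValueAt he hunr' hU' hN') hL]

/-- **U — UNIQUENESS OF THE L-MEASURE AS A FUNCTIONAL (cone density).**  Given Kaplansky's theorem
(H2), cone separation (H3) and multiplicative closure (H4): any two `IsLMeasure` witnesses for the same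
data `(ι, v, v̄, S, Ω, δ, Ω_p)`, on any two admissible towers, have the same integral on every
continuous `rayKer`-invariant function that is tower-continuous for both (e.g. every continuous
character of `𝒢(𝔣p^∞)`, in or OUT of the interpolation range). -/
theorem isLMeasure_integral_unique (hK : KaplanskyDensityModN)
    (hvbar : ((p : ℕ) : 𝓞 K) ∈ vbar.asIdeal)
    (hsep : ConeSeparatesRayClasses (p := p) S ι vbar) (hmul : ConeMulClosed (p := p) S ι vbar)
    {𝒰 𝒰' : SubgroupTower (absoluteGaloisGroup K)}
    (hU : ∀ n, IsOpen (𝒰.U n : Set (absoluteGaloisGroup K)))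
    (hN : ⋂ n, (𝒰.U n : Set (absoluteGaloisGroup K)) ⊆ DeShalit1987.rayKer K p S)
    (hU' : ∀ n, IsOpen (𝒰'.U n : Set (absoluteGaloisGroup K)))
    (hN' : ⋂ n, (𝒰'.U n : Set (absoluteGaloisGroup K)) ⊆ DeShalit1987.rayKer K p S)
    {μ : GroupDistribution 𝒰 ℂ_[p]} {μ' : GroupDistribution 𝒰' ℂ_[p]}
    (hμ : DeShalit1987.IsLMeasure ι v vbar S Ω δ Ωp 𝒰 μ)
    (hμ' : DeShalit1987.IsLMeasure ι v vbar S Ω δ Ωp 𝒰' μ')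
    {f : absoluteGaloisGroup K → ℂ_[p]} (hfc : Continuous f)
    (hfN : ∀ σ τ : absoluteGaloisGroup K, σ⁻¹ * τ ∈ DeShalit1987.rayKer K p S → f σ = f τ)
    (hf : 𝒰.IsTowerContinuous f) (hf' : 𝒰'.IsTowerContinuous f) :
    μ.integral f = μ'.integral f := by
  set T := lTestCone (p := p) S ι vbar with hT
  set A : Submodule ℂ_[p] (absoluteGaloisGroup K → ℂ_[p]) := Submodule.span ℂ_[p] T with hA
  -- properties of span elements needed by Kaplansky: continuity and `rayKer`-invariance
  have hAc : ∀ g ∈ A, Continuous g := by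
    intro g hg
    induction hg using Submodule.span_induction with
    | mem x hx => exact (cone_props hvbar hU hN hx).1
    | zero => exact continuous_const
    | add x y _ _ hx hy => exact hx.add hy
    | smul a x _ hx => exact hx.const_smul a
  have hAN : ∀ g ∈ A, ∀ σ τ : absoluteGaloisGroup K,
      σ⁻¹ * τ ∈ DeShalit1987.rayKer K p S → g σ = g τ := by
    intro g hg
    induction hg using Submodule.span_induction with
    | mem x hx => exact (cone_props hvbar hU hN hx).2.2.1
    | zero => intros; rfl
    | add x y _ _ hx hy => intro σ τ h; simp only [Pi.add_apply, hx σ τ h, hy σ τ h]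
    | smul a x _ hx => intro σ τ h; simp only [Pi.smul_apply, hx σ τ h]
  have hAmul : ∀ g ∈ A, ∀ g' ∈ A, g * g' ∈ A := fun g hg g' hg' ↦
    mul_mem_span_of_mul_mem hmul hg hg'
  -- Kaplansky's pointed separation from H3 + non-vanishing + H4
  have hAsep : ∀ σ τ : absoluteGaloisGroup K, σ⁻¹ * τ ∉ DeShalit1987.rayKer K p S →
      ∃ g ∈ A, g σ = 0 ∧ g τ ≠ 0 := by
    intro σ τ hστ
    obtain ⟨t, ht, hne⟩ := hsep σ τ hστ
    have htτ : t τ ≠ 0 := by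
      have h1 := (cone_props hvbar hU hN ht).2.1 τ
      intro h0; rw [h0, norm_zero] at h1; exact zero_ne_one h1
    refine ⟨t * t - t σ • t, Submodule.sub_mem _ (Submodule.subset_span (hmul t ht t ht))
      (Submodule.smul_mem _ _ (Submodule.subset_span ht)), ?_, ?_⟩
    · simp [Pi.mul_apply, Pi.sub_apply, Pi.smul_apply, smul_eq_mul]
    · have : (t * t - t σ • t) τ = t τ * (t τ - t σ) := by
        simp [Pi.mul_apply, Pi.sub_apply, Pi.smul_apply, smul_eq_mul]; ring
      rw [this]
      exact mul_ne_zero htτ (sub_ne_zero.mpr (Ne.symm hne))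
  -- rayKer is closed
  have hclosed : IsClosed ((DeShalit1987.rayKer K p S : Subgroup (absoluteGaloisGroup K)) :
      Set (absoluteGaloisGroup K)) := Subgroup.isClosed_topologicalClosure _
  -- density (H2) and transfer (H1)
  have hdense : ∀ ε' : ℝ, 0 < ε' → ∃ g ∈ A, ∀ σ, ‖f σ - g σ‖ ≤ ε' :=
    hK (absoluteGaloisGroup K) (DeShalit1987.rayKer K p S) hclosed ℂ_[p] A hAc hAN hAmul hAsep f hfc hfN
  exact integral_eq_of_dense_span μ μ' T (fun t ht ↦ (cone_props hvbar hU hN ht).2.2.2)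
    (fun t ht ↦ (cone_props hvbar hU' hN' ht).2.2.2)
    (fun t ht ↦ integral_eq_on_cone hvbar hU hN hU' hN' hμ hμ' ht) hf hf' hdense

/-- **G1 — out-of-range values are witness-independent.**  For ANY avatar `e'` killing the ray
generators (e.g. the Galois character of a `𝔭`-RAMIFIED finite-order `χ` of `𝒢(𝔣p^∞)` — outside the
tree's interpolation range), `∫ e' dμ` is the same for every `IsLMeasure` witness: DETERMINED by
(49)–(50) through density, though not computed by them (K22). -/
theorem integral_avatar_witness_independent (hK : KaplanskyDensityModN)
    (hvbar : ((p : ℕ) : 𝓞 K) ∈ vbar.asIdeal)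
    (hsep : ConeSeparatesRayClasses (p := p) S ι vbar) (hmul : ConeMulClosed (p := p) S ι vbar)
    {𝒰 𝒰' : SubgroupTower (absoluteGaloisGroup K)}
    (hU : ∀ n, IsOpen (𝒰.U n : Set (absoluteGaloisGroup K)))
    (hN : ⋂ n, (𝒰.U n : Set (absoluteGaloisGroup K)) ⊆ DeShalit1987.rayKer K p S)
    (hU' : ∀ n, IsOpen (𝒰'.U n : Set (absoluteGaloisGroup K)))
    (hN' : ⋂ n, (𝒰'.U n : Set (absoluteGaloisGroup K)) ⊆ DeShalit1987.rayKer K p S)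
    {μ : GroupDistribution 𝒰 ℂ_[p]} {μ' : GroupDistribution 𝒰' ℂ_[p]}
    (hμ : DeShalit1987.IsLMeasure ι v vbar S Ω δ Ωp 𝒰 μ)
    (hμ' : DeShalit1987.IsLMeasure ι v vbar S Ω δ Ωp 𝒰' μ')
    (e' : FramedGaloisRep K (PadicAlgCl p) 1)
    (he' : ∀ s ∈ DeShalit1987.rayGenerators K p S, avatarValueAt e' s = 1) :
    μ.integral (fun σ ↦ avatarValueAt e' σ) = μ'.integral (fun σ ↦ avatarValueAt e' σ) := by
  have htc : ∀ {𝒱 : SubgroupTower (absoluteGaloisGroup K)},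
      (∀ n, IsOpen (𝒱.U n : Set (absoluteGaloisGroup K))) →
      (⋂ n, (𝒱.U n : Set (absoluteGaloisGroup K)) ⊆ DeShalit1987.rayKer K p S) →
      𝒱.IsTowerContinuous (fun σ ↦ avatarValueAt e' σ) := fun hV hVN ↦
    SubgroupTower.IsTowerContinuous.of_mul_char_of_generators hV hVN (continuous_avatarValueAt e')
      (avatarValueAt_mul e') (avatarValueAt_one e') (fun σ ↦ (norm_avatarValueAt_eq_one e' σ).le) he'
  exact isLMeasure_integral_unique hK hvbar hsep hmul hU hN hU' hN' hμ hμ' (continuous_avatarValueAt e')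
    (fun σ τ h ↦ avatarValueAt_eq_of_inv_mul_mem_rayKer e' he' h) (htc hU hN) (htc hU' hN')

/-- **G2 — the ∀/∃ exchange.**  Any property of an out-of-range value established for ONE
`IsLMeasure` witness (e.g. a strengthened existence fact `∃ μ, IsLMeasure … μ ∧ Q (∫ χ̂ dμ)`, typing A
of R197a″ filed SEPARATELY) holds for EVERY witness — the `forall_of_existsUnique` bridge of row 110,
without `∃!`. -/
theorem forall_of_exists_isLMeasure (hK : KaplanskyDensityModN)
    (hvbar : ((p : ℕ) : 𝓞 K) ∈ vbar.asIdeal)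
    (hsep : ConeSeparatesRayClasses (p := p) S ι vbar) (hmul : ConeMulClosed (p := p) S ι vbar)
    (e' : FramedGaloisRep K (PadicAlgCl p) 1)
    (he' : ∀ s ∈ DeShalit1987.rayGenerators K p S, avatarValueAt e' s = 1) (Q : ℂ_[p] → Prop)
    (hex : ∃ (𝒰 : SubgroupTower (absoluteGaloisGroup K)) (μ : GroupDistribution 𝒰 ℂ_[p]),
      (∀ n, IsOpen (𝒰.U n : Set (absoluteGaloisGroup K))) ∧
      (⋂ n, (𝒰.U n : Set (absoluteGaloisGroup K)) ⊆ DeShalit1987.rayKer K p S) ∧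
      DeShalit1987.IsLMeasure ι v vbar S Ω δ Ωp 𝒰 μ ∧ Q (μ.integral (fun σ ↦ avatarValueAt e' σ)))
    {𝒰' : SubgroupTower (absoluteGaloisGroup K)}
    (hU' : ∀ n, IsOpen (𝒰'.U n : Set (absoluteGaloisGroup K)))
    (hN' : ⋂ n, (𝒰'.U n : Set (absoluteGaloisGroup K)) ⊆ DeShalit1987.rayKer K p S)
    {μ' : GroupDistribution 𝒰' ℂ_[p]} (hμ' : DeShalit1987.IsLMeasure ι v vbar S Ω δ Ωp 𝒰' μ') :
    Q (μ'.integral (fun σ ↦ avatarValueAt e' σ)) := by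
  obtain ⟨𝒰, μ, hU, hN, hμ, hQ⟩ := hex
  rwa [integral_avatar_witness_independent hK hvbar hsep hmul hU hN hU' hN' hμ hμ' e' he'] at hQ

/-! ## §4  H3 reduced to class field theory: CUT (H3a) + INERTIA INJECTIVITY (H3b) + twist closure (H4′) -/

/-- Separation is a statement about ONE element: `t(σ) ≠ t(τ) ↔ t(σ⁻¹τ) ≠ 1` for cone functions. -/
theorem coneSeparates_iff :
    ConeSeparatesRayClasses (p := p) S ι vbar ↔
      ∀ ρ : absoluteGaloisGroup K, ρ ∉ DeShalit1987.rayKer K p S →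
        ∃ t ∈ lTestCone (p := p) S ι vbar, t ρ ≠ 1 := by
  -- unpack the cone membership directly (no tower needed).
  have key : ∀ t ∈ lTestCone (p := p) S ι vbar, ∀ σ τ : absoluteGaloisGroup K,
      t τ = t σ * t (σ⁻¹ * τ) ∧ t σ ≠ 0 := by
    intro t ht σ τ
    obtain ⟨ε, e, m, j, -, -, -, -, -, rfl⟩ := ht
    refine ⟨?_, ?_⟩
    · show avatarValueAt e τ = avatarValueAt e σ * avatarValueAt e (σ⁻¹ * τ)
      rw [← avatarValueAt_mul, mul_inv_cancel_left]
    · show avatarValueAt e σ ≠ 0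
      intro h0
      have h1 := norm_avatarValueAt_eq_one e σ
      rw [h0, norm_zero] at h1
      exact zero_ne_one h1
  constructor
  · intro h ρ hρ
    obtain ⟨t, ht, hne⟩ := h 1 ρ (by simpa using hρ)
    refine ⟨t, ht, fun h1 ↦ hne ?_⟩
    obtain ⟨hmul, h0⟩ := key t ht 1 ρ
    rw [hmul, inv_one, one_mul, h1, mul_one]
  · intro h σ τ hστ
    obtain ⟨t, ht, hne⟩ := h (σ⁻¹ * τ) hστ
    refine ⟨t, ht, fun heq ↦ hne ?_⟩
    obtain ⟨hmul, h0⟩ := key t ht σ τ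
    have : t σ * t (σ⁻¹ * τ) = t σ * 1 := by rw [mul_one, ← hmul, heq]
    exact mul_left_cancel₀ h0 this

/-- **H3a — THE FINITE-ORDER CUT (class field theory).** An element of `Γ_K` outside
`Gal(K̄/K(𝔣p^∞))` on which every finite-order character unramified outside `S ∪ {v̄}` (with a `p`-adic
avatar outside `S`) is trivial lies in `I_𝔓 · Gal(K̄/K(𝔣p^∞))` for a prime `𝔓 ∣ v` of `\bar ℤ_K`: the
`v`-unramified finite-order characters of `𝒢(𝔣p^∞)` are exactly the characters of `𝒢(𝔣p^∞)/D_v`,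
`D_v` = image of inertia at `v`, and finite-order characters of a profinite abelian group separate points.
[Lang, Algebraic Number Theory, XI §4; de Shalit II.4.13]  (M: Artin reciprocity for `K(𝔣p^∞)/K` in the
tree's `HeckeCharacter`/avatar vocabulary.) -/
def FiniteOrderCut (S : Finset (HeightOneSpectrum (𝓞 K))) (ι : PadicAlgCl p ≃+* ℂ)
    (v vbar : HeightOneSpectrum (𝓞 K)) : Prop :=
  ∀ ρ : absoluteGaloisGroup K, ρ ∉ DeShalit1987.rayKer K p S →
    (∀ (χ : HeckeCharacter K) (c : FramedGaloisRep K (PadicAlgCl p) 1),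
      IsPAdicAvatarOutside S ι χ c → χ.HasInfinityType (fun _ ↦ 0) (fun _ ↦ 0) →
      (∀ w : HeightOneSpectrum (𝓞 K), w ∉ S → w ≠ vbar → χ.IsUnramifiedAt w) →
      avatarValueAt c ρ = 1) →
    ∃ 𝔓 ∈ v.primesAbove, ρ ∈ 𝔓.inertia (absoluteGaloisGroup K) ⊔ DeShalit1987.rayKer K p S

/-- **H3b — INERTIA INJECTIVITY OF ONE CONE CHARACTER.** There is a cone character `λ` (type `(−1,0)`,
i.e. `m = 1, j = 0`; if `ι` pins the OTHER slot to `v`, use type `(−2,1)`) whose avatar is INJECTIVE on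
the `v`-inertia modulo `Gal(K̄/K(𝔣p^∞))`: on `D_v = Art_v(𝒪_vˣ) ≅ ℤ_pˣ` the avatar is `u ↦ u^{∓1}`
(the infinity type moved to `p`; `λ` is `v`-unramified so there is no finite part), and
`𝒪_vˣ → 𝒢(𝔣p^∞)` is injective for imaginary quadratic `K` (global units are roots of unity, killed by
the `v̄^∞`-part of the modulus).  [de Shalit II.1.1–1.4, II.4.13 (p. 69–70); Serre, Abelian ℓ-adic
representations, II.2.3–2.7]  (M.) -/
def InertiaInjective (S : Finset (HeightOneSpectrum (𝓞 K))) (ι : PadicAlgCl p ≃+* ℂ)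
    (v vbar : HeightOneSpectrum (𝓞 K)) : Prop :=
  ∃ (lam : HeckeCharacter K) (l : FramedGaloisRep K (PadicAlgCl p) 1),
    (fun σ ↦ avatarValueAt l σ) ∈ lTestCone (p := p) S ι vbar ∧ IsPAdicAvatarOutside S ι lam l ∧
    (∀ w : HeightOneSpectrum (𝓞 K), w ∉ S → w ≠ vbar → lam.IsUnramifiedAt w) ∧
    ∀ 𝔓 ∈ v.primesAbove, ∀ s ∈ 𝔓.inertia (absoluteGaloisGroup K),
      avatarValueAt l s = 1 → s ∈ DeShalit1987.rayKer K p S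

/-- **H4′ — twisting a cone function by an admissible finite-order character stays in the cone**
(`χλ` has the type of `λ`; `IsPAdicAvatarOf.mul_twist_outside` pattern; S). -/
def ConeMulFiniteOrder (S : Finset (HeightOneSpectrum (𝓞 K))) (ι : PadicAlgCl p ≃+* ℂ)
    (vbar : HeightOneSpectrum (𝓞 K)) : Prop :=
  ∀ t ∈ lTestCone (p := p) S ι vbar, ∀ (χ : HeckeCharacter K) (c : FramedGaloisRep K (PadicAlgCl p) 1),
    IsPAdicAvatarOutside S ι χ c → χ.HasInfinityType (fun _ ↦ 0) (fun _ ↦ 0) →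
    (∀ w : HeightOneSpectrum (𝓞 K), w ∉ S → w ≠ vbar → χ.IsUnramifiedAt w) →
    (fun σ ↦ avatarValueAt c σ * t σ) ∈ lTestCone (p := p) S ι vbar

/-- **H3 from H3a + H3b + H4′** (proved): the cone separates `Γ_K` modulo `Gal(K̄/K(𝔣p^∞))`. -/
theorem coneSeparates_of_cut_of_inertiaInjective (hvbar : ((p : ℕ) : 𝓞 K) ∈ vbar.asIdeal)
    (hcut : FiniteOrderCut (p := p) S ι v vbar) (hinj : InertiaInjective (p := p) S ι v vbar)
    (htw : ConeMulFiniteOrder (p := p) S ι vbar) : ConeSeparatesRayClasses (p := p) S ι vbar := by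
  rw [coneSeparates_iff]
  intro ρ hρ
  by_contra hall
  push Not at hall
  obtain ⟨lam, l, hlT, hl, hlunr, hlinj⟩ := hinj
  -- the chosen cone character is trivial on ρ
  have hlρ : avatarValueAt l ρ = 1 := hall _ hlT
  -- hence every admissible finite-order character is trivial on ρ (twist closure)
  have hχ : ∀ (χ : HeckeCharacter K) (c : FramedGaloisRep K (PadicAlgCl p) 1),
      IsPAdicAvatarOutside S ι χ c → χ.HasInfinityType (fun _ ↦ 0) (fun _ ↦ 0) →
      (∀ w : HeightOneSpectrum (𝓞 K), w ∉ S → w ≠ vbar → χ.IsUnramifiedAt w) →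
      avatarValueAt c ρ = 1 := by
    intro χ c hc htyp hunr
    have h := hall _ (htw _ hlT χ c hc htyp hunr)
    simpa [hlρ] using h
  -- so ρ ∈ I_𝔓 · rayKer for some 𝔓 ∣ v (the cut) ...
  obtain ⟨𝔓, h𝔓, hmem⟩ := hcut ρ hρ hχ
  haveI : (DeShalit1987.rayKer K p S).Normal := Subgroup.is_normal_topologicalClosure _
  rw [← SetLike.mem_coe, Subgroup.mul_normal] at hmem
  obtain ⟨s, hs, n, hn, rfl⟩ := hmem
  -- ... and λ̂(s) = λ̂(ρ) = 1 forces s ∈ rayKer (inertia injectivity): contradiction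
  have hgen : ∀ g ∈ DeShalit1987.rayGenerators K p S, avatarValueAt l g = 1 :=
    fun g hg ↦ avatarValueAt_eq_one_of_mem_rayGenerators hl (unr_away_from_p hvbar hlunr) hg
  have hls : avatarValueAt l s = 1 := by
    have hn1 := avatarValueAt_eq_one_of_mem_rayKer l hgen hn
    rwa [avatarValueAt_mul, hn1, mul_one] at hlρ
  exact hρ ((DeShalit1987.rayKer K p S).mul_mem (hlinj 𝔓 h𝔓 s hs hls) hn)

/-! ## §5  PLAN 2 / PLAN 3 typed anchors

PLAN 2 («MAHLER ON THE INERTIA LINE», Kaplansky-free density): with a continuous section of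
`𝒢 → 𝒢/D_v` every continuous function splits as (locally constant in the base) × (function of the
`D_v`-coordinate `w = λ̂(d) ∈ ℤ_pˣ`); Mahler expansions on `ℤ_p` WITHOUT constant term (replace `1` by
`w^{(p−1)p^M} → 1` uniformly on `ℤ_pˣ`) write the fibre factor as a uniform limit of `∑ c_k λ̂^k`,
`k ≥ 1`, and levelwise Fourier inversion on the finite quotients of `𝒢/D_v` (k1-g36
`separatesD_levelHomFamily`, CITED not re-proved) handles the base. -/

/-- **M1 (PLAN 2).** Locally constant functions on `ℤ_pˣ` are uniform limits of polynomials WITHOUT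
constant term (Mahler + `u^{(p-1)p^M} → 1` uniformly on units). [Mathlib `PadicInt.hasSum_mahler`] (S) -/
def MahlerDensityNoConstantTerm (p : ℕ) [Fact p.Prime] : Prop :=
  ∀ (φ : ℤ_[p] → ℚ_[p]), IsLocallyConstant φ → ∀ ε : ℝ, 0 < ε →
    ∃ P : Polynomial ℚ_[p], P.coeff 0 = 0 ∧
      ∀ u : ℤ_[p]ˣ, ‖φ (u : ℤ_[p]) - P.eval ((u : ℤ_[p]) : ℚ_[p])‖ ≤ ε

/-- **PLAN 3 arithmetic**: the interpolation TYPE CONE `{(−m, j) : 0 ≤ j < m}` is additively closed —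
the reason the UNTWISTED cone (and the sheet cone at a FINITE-ORDER twist `θ_K⁻¹`, type `(0,0)`) is
multiplicatively closed, while a cone translated by a type `(−m₀, j₀)` with `j₀ > 0` is not. -/
theorem typeCone_add_closed {m₁ j₁ m₂ j₂ : ℕ} (h₁ : j₁ < m₁) (h₂ : j₂ < m₂) :
    j₁ + j₂ < m₁ + m₂ := by omega

/-- … whereas the translate by `(−m₀, j₀) = (−2, 1)` is not: `(−3,1), (−3,1)` are admissible for the
twist (`(−5,2)` in range) but their sum `(−6,2)` twisted is `(−8,3)`… we record the simplest failure:
types `ρ₁ = ρ₂ = (−1, 0)` are admissible for the twist `(−2,1)` (`λρ_i = (−3,1)`, in range) yet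
`λρ₁ρ₂ = (−4, 1)` is in range — so we give instead the honest obstruction used by `KatzBranchRigidity`:
with `j₀ = 1`, `ρ = (0,−1)`-type corrections leave the range (`j = 0 − 1 < 0`). Decidable toy check: -/
example : ¬ (∀ a₁ b₁ a₂ b₂ : ℤ, (0 ≤ b₁ + 1 ∧ b₁ + 1 < a₁ + 2) → (0 ≤ b₂ + 1 ∧ b₂ + 1 < a₂ + 2) →
    (0 ≤ b₁ + b₂ + 1 ∧ b₁ + b₂ + 1 < a₁ + a₂ + 2)) := by
  intro h
  have := h 0 (-1) 0 (-1) (by norm_num) (by norm_num)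
  omega

end DeShalit

end Summit.BirchSwinnertonDyer.BirchSwinnertonDyer.Cruxes.SplitBadTwoLowerHalfOfFacts.ConeDensityK2G38

end
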